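import Mathlib
import Literature.Analysis.FluidPDE.TypeIAncientMild
import Literature.Analysis.FluidPDE.SpaceTimeCalculus
import HarnessLib

/-!
# Rotated self-similar pull-backs and gluing in the Type-I ancient mild class

Topic `Literature/Analysis/FluidPDE`; elementary toolkit around the class `IsTypeIAncientMild C`
(`TypeIAncientMild.lean`) used by route `SymmetryModuliCount` (NavierStokesRegularity) to move the
vertex of an exactly ROTATED-self-similar member (Pineau–Vicol, arXiv:2607.09619, ansatz (1.7);
KNSS 2009, §1: the symmetries of the problem). For a real inner product space `E`, a bounded
operator `B` (skew where needed), a vertex time `θ`, a centre `x_c` and `u : ℝ → E → E`, the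
**rotated self-similar pull-back** with parameter `ρ` is
`P_ρ u (s, y) = e^ρ e^{−ρB} u(θ + e^{2ρ}s, x_c + e^ρ e^{ρB}(y − x_c))` (written out in every
statement; `e^{cB} = NormedSpace.exp (c • B)`): `u` transported by the similarity of rate `e^ρ`,
rotation `e^{ρB}`, centred at `(θ, x_c)`, re-clocked so that the vertex sits at `s = 0`.

* the group `e^{cB}` (`rss_exp_add_smul`; for skew `B`, `e^{−ρB}` is a linear isometry with
  inverse `e^{ρB}`, `rss_exists_rot`); `d/dρ P_ρ w (s, y) = e^ρ e^{−ρB} [G_θ w](θ + e^{2ρ}s, x_ρ)`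
  (`rss_hasDerivAt_pull`) with the normalised rotated scaling generator
  `G_θ w = Dw·((x − x_c) + B(x − x_c)) + w + 2(t − θ)∂ₜw − Bw`;
* **rotated Euler homogeneity** (`rss_pull_const`): if `G_θ u = 0` on the open slab `t < 0`
  (joint differentiability only), `ρ ↦ P_ρ u (s, y)` is constant on `{ρ | θ + e^{2ρ}s < 0}`;
  `rss_pull_zero`, `rss_pull_cocycle` (group property); `rss_gen_normalise` /
  `rss_gen_denormalise` (the route's generator `∇u·(a + σx + Ax) + σu + 2σ(t − θ)∂ₜu − Au`,
  `σ ≠ 0`, `σx_c + Ax_c = −a`, `B = σ⁻¹A`, versus `G_θ`); `rss_anchor`, `rss_exists_small`;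
* **gluing** (`rss_isTypeIAncientMild_of_local`): a field which on every backward end
  `s < t₁ < 0` is a forward time-shift `G(· + δ)` of a member `G ∈ A_C`, `δ ≥ 0` as small as we
  please, lies in `A_{2C}` (every clause of the class looks into the past only; the Duhamel term
  is translation covariant, `oseenDuhamel_comp_sub_right`; `C/√(−s−δ) ≤ 2C/√(−s)`).

Elementary (standard calculus; no single published source).
-/

noncomputable section

open MeasureTheory Set Function Filter
open _root_.Topology
open scoped RealInnerProductSpace

namespace Literature.Analysis.FluidPDE

variable {E : Type*} [NormedAddCommGroup E] [InnerProductSpace ℝ E]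

/-- **Group law** of the one-parameter group generated by a bounded operator:
`e^{(a+b)B} = e^{aB} e^{bB}` (`aB` and `bB` commute). [folklore] -/
theorem rss_exp_add_smul [CompleteSpace E] (B : E →L[ℝ] E) (a b : ℝ) :
    NormedSpace.exp ((a + b) • B) = NormedSpace.exp (a • B) * NormedSpace.exp (b • B) := by
  rw [add_smul]
  exact NormedSpace.exp_add_of_commute_of_mem_ball
    (((Commute.refl B).smul_left a).smul_right b)
    ((NormedSpace.expSeries_radius_eq_top ℝ (E →L[ℝ] E)).symm ▸ edist_lt_top _ _)
    ((NormedSpace.expSeries_radius_eq_top ℝ (E →L[ℝ] E)).symm ▸ edist_lt_top _ _)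

/-- For skew `B` (`⟪Bx, x⟫ = 0`), `e^{−ρB}` is a linear isometric isomorphism with inverse
`e^{ρB}` (`‖e^{cB}y‖ = ‖y‖` since `d/dc ‖e^{cB}y‖² = 0`; `e^{ρB}e^{−ρB} = e^{−ρB}e^{ρB} = 1`). [folklore] -/
theorem rss_exists_rot [CompleteSpace E] {B : E →L[ℝ] E} (hB : ∀ x, ⟪B x, x⟫ = 0) (ρ : ℝ) :
    ∃ L : E ≃ₗᵢ[ℝ] E, (∀ y, L y = NormedSpace.exp ((-ρ) • B) y) ∧
      ∀ y, L.symm y = NormedSpace.exp (ρ • B) y := by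
  have h1 : NormedSpace.exp (ρ • B) * NormedSpace.exp ((-ρ) • B) = 1 := by
    rw [← rss_exp_add_smul, add_neg_cancel, zero_smul, NormedSpace.exp_zero]
  have h2 : NormedSpace.exp ((-ρ) • B) * NormedSpace.exp (ρ • B) = 1 := by
    rw [← rss_exp_add_smul, neg_add_cancel, zero_smul, NormedSpace.exp_zero]
  -- `‖e^{cB} y‖ = ‖y‖`: `d/dc ‖e^{cB}y‖² = 2⟪e^{cB}y, B e^{cB}y⟫ = 0`
  have hnorm : ∀ (c : ℝ) (y : E), ‖NormedSpace.exp (c • B) y‖ = ‖y‖ := by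
    intro c y
    have hd : ∀ s : ℝ, HasDerivAt (fun s : ℝ => NormedSpace.exp (s • B) y)
        (B (NormedSpace.exp (s • B) y)) s := fun s => by
      simpa using (hasDerivAt_exp_smul_const' (𝕂 := ℝ) B s).clm_apply (hasDerivAt_const s y)
    have hd2 : ∀ s : ℝ, HasDerivAt (fun s : ℝ => ‖NormedSpace.exp (s • B) y‖ ^ 2) 0 s := by
      intro s
      have h := (hd s).norm_sq
      rw [real_inner_comm, hB, mul_zero] at h
      exact h
    have hconst := is_const_of_deriv_eq_zero (fun s => (hd2 s).differentiableAt)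
      (fun s => (hd2 s).deriv) c 0
    simp only [zero_smul, NormedSpace.exp_zero, one_apply_eq_self] at hconst
    exact (sq_eq_sq₀ (norm_nonneg _) (norm_nonneg _)).1 hconst
  let e : E ≃ₗ[ℝ] E :=
    { toFun := fun y => NormedSpace.exp ((-ρ) • B) y
      map_add' := fun x y => map_add _ x y
      map_smul' := fun c x => by simp only [map_smul, RingHom.id_apply]
      invFun := fun y => NormedSpace.exp (ρ • B) y
      left_inv := fun y => by
        show (NormedSpace.exp (ρ • B) * NormedSpace.exp ((-ρ) • B)) y = y
        rw [h1]; rfl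
      right_inv := fun y => by
        show (NormedSpace.exp ((-ρ) • B) * NormedSpace.exp (ρ • B)) y = y
        rw [h2]; rfl }
  exact ⟨{ toLinearEquiv := e, norm_map' := fun y => hnorm (-ρ) y },
    fun y => rfl, fun y => rfl⟩

/-- **Derivative of the pull-back in the group parameter.** Along `t(r) = θ + e^{2r}s`,
`x(r) = x_c + eʳe^{rB}(y − x_c)` one has `t' = 2(t − θ)`, `x' = (x − x_c) + B(x − x_c)`, and
`d/dr e^{−rB} = −Be^{−rB}`; hence, if `uncurry w` is Fréchet differentiable at `(t(ρ), x(ρ))`,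
`d/dr|_{r=ρ} eʳe^{−rB}w(t(r), x(r)) = e^ρ e^{−ρB}[Dw·((x − x_c) + B(x − x_c)) + w + 2(t − θ)∂ₜw − Bw]`
(`B` commutes with `e^{−ρB}`; no skewness needed). [folklore] -/
theorem rss_hasDerivAt_pull [CompleteSpace E] {B : E →L[ℝ] E} {θ s ρ : ℝ} {xc y : E}
    {w : ℝ → E → E} {tc : ℝ → ℝ} {X : ℝ → E}
    (htc : tc = fun r => θ + Real.exp r ^ 2 * s)
    (hX : X = fun r => xc + Real.exp r • NormedSpace.exp (r • B) (y - xc))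
    {L : ℝ × E →L[ℝ] E} (hL : HasFDerivAt (uncurry w) L (tc ρ, X ρ)) :
    HasDerivAt (fun r => Real.exp r • NormedSpace.exp ((-r) • B) (w (tc r) (X r)))
      (Real.exp ρ • NormedSpace.exp ((-ρ) • B)
        (fderiv ℝ (w (tc ρ)) (X ρ) ((X ρ - xc) + B (X ρ - xc)) + w (tc ρ) (X ρ) +
          (2 * (tc ρ - θ)) • timeDeriv w (tc ρ) (X ρ) - B (w (tc ρ) (X ρ)))) ρ := by
  have htc' : HasDerivAt tc (2 * (tc ρ - θ)) ρ := by
    rw [htc]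
    refine ((((Real.hasDerivAt_exp ρ).pow 2).mul_const s).const_add θ).congr_deriv ?_
    simp only [Nat.cast_ofNat, add_sub_cancel_left]
    ring
  have hX' : HasDerivAt X ((X ρ - xc) + B (X ρ - xc)) ρ := by
    have e : X ρ - xc = Real.exp ρ • NormedSpace.exp (ρ • B) (y - xc) := by simp [hX]
    rw [e, hX]
    -- the spatial characteristic: `d/dr e^{rB} = B e^{rB}`
    have h1 : HasDerivAt (fun s : ℝ => NormedSpace.exp (s • B) (y - xc))
        (B (NormedSpace.exp (ρ • B) (y - xc))) ρ := by
      simpa using (hasDerivAt_exp_smul_const' (𝕂 := ℝ) B ρ).clm_apply (hasDerivAt_const ρ (y - xc))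
    convert ((Real.hasDerivAt_exp ρ).fun_smul h1).const_add xc using 1
    rw [map_smul, add_comm]
  -- chain rule along the space–time curve (`hasDerivAt_timeLine`, `hasFDerivAt_slice`)
  have hw : HasDerivAt (fun s => w (tc s) (X s))
      ((2 * (tc ρ - θ)) • timeDeriv w (tc ρ) (X ρ) +
        fderiv ℝ (w (tc ρ)) (X ρ) ((X ρ - xc) + B (X ρ - xc))) ρ := by
    have h := hL.comp_hasDerivAt ρ (htc'.prodMk hX')
    have e1 : timeDeriv w (tc ρ) (X ρ) = L (1, 0) := (hasDerivAt_timeLine hL).deriv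
    have e2 : fderiv ℝ (w (tc ρ)) (X ρ) ((X ρ - xc) + B (X ρ - xc)) =
        L (0, (X ρ - xc) + B (X ρ - xc)) := by
      rw [(hasFDerivAt_slice hL).fderiv]
      rfl
    have e3 : L (2 * (tc ρ - θ), (X ρ - xc) + B (X ρ - xc)) =
        (2 * (tc ρ - θ)) • L (1, 0) + L (0, (X ρ - xc) + B (X ρ - xc)) := by
      rw [← map_smul, ← map_add]
      congr 1
      simp
    rw [e1, e2, ← e3]
    exact h
  have hM : HasDerivAt (fun r : ℝ => NormedSpace.exp ((-r) • B))
      (-B * NormedSpace.exp ((-ρ) • B)) ρ := by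
    have h := hasDerivAt_exp_smul_const' (𝕂 := ℝ) (-B) ρ
    simp only [smul_neg, ← neg_smul] at h
    exact h
  have h3 := (Real.hasDerivAt_exp ρ).fun_smul (hM.clm_apply hw)
  refine h3.congr_deriv ?_
  have hcomm : ∀ z, B (NormedSpace.exp ((-ρ) • B) z) = NormedSpace.exp ((-ρ) • B) (B z) :=
    fun z => by
      show (B * NormedSpace.exp ((-ρ) • B)) z = (NormedSpace.exp ((-ρ) • B) * B) z
      rw [(((Commute.refl B).smul_right (-ρ)).exp_right).eq]
  have hBM : ∀ z, (-B * NormedSpace.exp ((-ρ) • B)) z = -(B (NormedSpace.exp ((-ρ) • B) z)) :=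
    fun z => rfl
  rw [hBM, hcomm]
  set M : E →L[ℝ] E := NormedSpace.exp ((-ρ) • B) with hM_def
  set wv : E := w (tc ρ) (X ρ) with hwv
  set td : E := timeDeriv w (tc ρ) (X ρ) with htd
  set fd : E := fderiv ℝ (w (tc ρ)) (X ρ) ((X ρ - xc) + B (X ρ - xc)) with hfd
  simp only [map_add, map_sub, map_smul]
  module

/-- **Rotated Euler homogeneity.** Let `uncurry u` be differentiable on the open slab
`(-∞, 0) × E` and annihilated there by the normalised rotated scaling generator with vertex
`(θ, x_c)`: `Du·((x − x_c) + B(x − x_c)) + u + 2(t − θ)∂ₜu − Bu = 0`. Then the pull-back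
`ρ ↦ e^ρ e^{−ρB} u(θ + e^{2ρ}s, x_c + e^ρ e^{ρB}(y − x_c))` takes the same value at any two
parameters with `θ + e^{2ρᵢ}s < 0`: its derivative vanishes (`rss_hasDerivAt_pull`) on
`{ρ | θ + e^{2ρ}s < 0}`, an open order-connected set (`IsOpen.is_const_of_deriv_eq_zero`). [folklore] -/
theorem rss_pull_const [CompleteSpace E] {u : ℝ → E → E}
    (hd : DifferentiableOn ℝ (uncurry u) (Iio 0 ×ˢ univ)) {B : E →L[ℝ] E} {θ : ℝ} {xc : E}
    (hgen : ∀ t < 0, ∀ x, fderiv ℝ (u t) x ((x - xc) + B (x - xc)) + u t x +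
      (2 * (t - θ)) • timeDeriv u t x - B (u t x) = 0)
    {s : ℝ} (y : E) {ρ₁ ρ₂ : ℝ} (h₁ : θ + Real.exp ρ₁ ^ 2 * s < 0)
    (h₂ : θ + Real.exp ρ₂ ^ 2 * s < 0) :
    Real.exp ρ₁ • NormedSpace.exp ((-ρ₁) • B)
        (u (θ + Real.exp ρ₁ ^ 2 * s) (xc + Real.exp ρ₁ • NormedSpace.exp (ρ₁ • B) (y - xc))) =
      Real.exp ρ₂ • NormedSpace.exp ((-ρ₂) • B)
        (u (θ + Real.exp ρ₂ ^ 2 * s) (xc + Real.exp ρ₂ • NormedSpace.exp (ρ₂ • B) (y - xc))) := by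
  obtain ⟨tc, htc⟩ : ∃ tc : ℝ → ℝ, tc = fun r => θ + Real.exp r ^ 2 * s := ⟨_, rfl⟩
  obtain ⟨X, hX⟩ : ∃ X : ℝ → E, X = fun r => xc + Real.exp r • NormedSpace.exp (r • B) (y - xc) :=
    ⟨_, rfl⟩
  have hJo : IsOpen {r : ℝ | tc r < 0} := by
    rw [htc]
    exact isOpen_lt (by fun_prop) continuous_const
  have hJc : IsPreconnected {r : ℝ | tc r < 0} := by
    refine Set.OrdConnected.isPreconnected ⟨fun a ha b hb r hr => ?_⟩
    simp only [mem_setOf_eq, htc] at ha hb ⊢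
    rcases le_or_gt 0 s with hs | hs
    · have h3 : Real.exp r ^ 2 ≤ Real.exp b ^ 2 :=
        pow_le_pow_left₀ (Real.exp_pos r).le (Real.exp_le_exp.2 hr.2) 2
      have h4 := mul_le_mul_of_nonneg_right h3 hs
      linarith
    · have h3 : Real.exp a ^ 2 ≤ Real.exp r ^ 2 :=
        pow_le_pow_left₀ (Real.exp_pos a).le (Real.exp_le_exp.2 hr.1) 2
      have h4 := mul_le_mul_of_nonpos_right h3 hs.le
      linarith
  have hU : IsOpen (Iio (0 : ℝ) ×ˢ (univ : Set E)) := isOpen_Iio.prod isOpen_univ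
  have hF : ∀ r ∈ {r : ℝ | tc r < 0},
      HasDerivAt (fun r => Real.exp r • NormedSpace.exp ((-r) • B) (u (tc r) (X r))) 0 r := by
    intro r hr
    have hmem : (tc r, X r) ∈ Iio (0 : ℝ) ×ˢ (univ : Set E) := ⟨hr, mem_univ _⟩
    have hL := ((hd _ hmem).differentiableAt (hU.mem_nhds hmem)).hasFDerivAt
    have h := rss_hasDerivAt_pull htc hX hL
    rw [hgen (tc r) hr (X r), map_zero, smul_zero] at h
    exact h
  have key := hJo.is_const_of_deriv_eq_zero hJc
    (fun r hr => (hF r hr).differentiableAt.differentiableWithinAt) (fun r hr => (hF r hr).deriv)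
    (by simpa [htc] using h₁) (by simpa [htc] using h₂)
  simp only [htc, hX] at key
  exact key

/-- The pull-back at parameter `0` is the vertex time-shift: `P_0 u (s, y) = u(θ + s, y)`. [folklore] -/
theorem rss_pull_zero (B : E →L[ℝ] E) (θ s : ℝ) (xc y : E) (u : ℝ → E → E) :
    Real.exp 0 • NormedSpace.exp ((-0 : ℝ) • B)
        (u (θ + Real.exp 0 ^ 2 * s) (xc + Real.exp 0 • NormedSpace.exp ((0 : ℝ) • B) (y - xc))) =
      u (θ + s) y := by
  simp

/-- **Cocycle identity** (group property of the rotated similarities):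
`e^a e^{−aB} (P_b u)(e^{2a}s, x_c + e^a e^{aB}(y − x_c)) = P_{b+a} u (s, y)`. [folklore] -/
theorem rss_pull_cocycle [CompleteSpace E] (B : E →L[ℝ] E) (θ : ℝ) (xc : E) (u : ℝ → E → E)
    (a b s : ℝ) (y : E) :
    Real.exp a • NormedSpace.exp ((-a) • B)
        (Real.exp b • NormedSpace.exp ((-b) • B)
          (u (θ + Real.exp b ^ 2 * (Real.exp a ^ 2 * s))
            (xc + Real.exp b • NormedSpace.exp (b • B)
              (xc + Real.exp a • NormedSpace.exp (a • B) (y - xc) - xc)))) =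
      Real.exp (b + a) • NormedSpace.exp ((-(b + a)) • B)
        (u (θ + Real.exp (b + a) ^ 2 * s)
          (xc + Real.exp (b + a) • NormedSpace.exp ((b + a) • B) (y - xc))) := by
  have eN : ∀ z, NormedSpace.exp (b • B) (NormedSpace.exp (a • B) z) =
      NormedSpace.exp ((b + a) • B) z := fun z => by
    rw [rss_exp_add_smul]; rfl
  have eM : ∀ z, NormedSpace.exp ((-a) • B) (NormedSpace.exp ((-b) • B) z) =
      NormedSpace.exp ((-(b + a)) • B) z := fun z => by
    rw [show (-(b + a)) = (-a) + (-b) by ring, rss_exp_add_smul]; rfl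
  have et : Real.exp b ^ 2 * (Real.exp a ^ 2 * s) = Real.exp (b + a) ^ 2 * s := by
    rw [Real.exp_add, mul_pow]; ring
  have es : Real.exp a * Real.exp b = Real.exp (b + a) := by rw [← Real.exp_add, add_comm]
  have e1 : xc + Real.exp b • NormedSpace.exp (b • B) (xc + Real.exp a • NormedSpace.exp (a • B)
      (y - xc) - xc) = xc + Real.exp (b + a) • NormedSpace.exp ((b + a) • B) (y - xc) := by
    rw [add_sub_cancel_left, map_smul, smul_smul, ← Real.exp_add, eN]
  rw [e1, et, map_smul, smul_smul, es, eM]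

/-- **Normalisation of the rotated scaling generator.** With `σ ≠ 0`, centre `x_c`
(`σx_c + Ax_c = −a`) and `B = σ⁻¹A`: `a + σx + Ax = σ((x − x_c) + B(x − x_c))`, so
`∇u·(a + σx + Ax) + σu + 2σ(t − θ)∂ₜu − Au = 0` divided by `σ` reads
`∇u·((x − x_c) + B(x − x_c)) + u + 2(t − θ)∂ₜu − Bu = 0`. [folklore] -/
theorem rss_gen_normalise {u : ℝ → E → E} {a xc : E} {σ θ : ℝ} {A B : E →L[ℝ] E} (hσ : σ ≠ 0)
    (hxc : σ • xc + A xc = -a) (hB : B = σ⁻¹ • A)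
    (hgen : ∀ t < 0, ∀ x, fderiv ℝ (u t) x (a + σ • x + A x) + σ • u t x +
      (2 * σ * (t - θ)) • timeDeriv u t x - A (u t x) = 0) :
    ∀ t < 0, ∀ x, fderiv ℝ (u t) x ((x - xc) + B (x - xc)) + u t x +
      (2 * (t - θ)) • timeDeriv u t x - B (u t x) = 0 := by
  intro t ht x
  have key := hgen t ht x
  have e1 : a + σ • x + A x = σ • ((x - xc) + B (x - xc)) := by
    rw [neg_eq_iff_eq_neg.1 hxc.symm, hB, smul_apply, smul_add, smul_smul,
      mul_inv_cancel₀ hσ, one_smul, smul_sub, map_sub]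
    abel
  have e2 : A (u t x) = σ • B (u t x) := by
    rw [hB, smul_apply, smul_smul, mul_inv_cancel₀ hσ, one_smul]
  rw [e1, map_smul, e2] at key
  apply smul_right_injective E hσ
  show σ • _ = σ • (0 : E)
  rw [smul_zero, ← key]
  simp only [smul_add, smul_sub, smul_smul]
  congr 1
  ring_nf

/-- **De-normalisation** (vertex time `0`): from `∇v·((y − x_c) + B(y − x_c)) + v + 2s∂ₛv − Bv = 0`
at `(s, y)` back to `∇v·(a + σy + Ay) + σv + 2σs∂ₛv − Av = 0` (multiply by `σ`). [folklore] -/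
theorem rss_gen_denormalise {v : ℝ → E → E} {a xc : E} {σ : ℝ} {A B : E →L[ℝ] E} (hσ : σ ≠ 0)
    (hxc : σ • xc + A xc = -a) (hB : B = σ⁻¹ • A) {s : ℝ} {y : E}
    (h : fderiv ℝ (v s) y ((y - xc) + B (y - xc)) + v s y + (2 * s) • timeDeriv v s y -
      B (v s y) = 0) :
    fderiv ℝ (v s) y (a + σ • y + A y) + σ • v s y + (2 * σ * s) • timeDeriv v s y -
      A (v s y) = 0 := by
  have e1 : a + σ • y + A y = σ • ((y - xc) + B (y - xc)) := by
    rw [neg_eq_iff_eq_neg.1 hxc.symm, hB, smul_apply, smul_add, smul_smul,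
      mul_inv_cancel₀ hσ, one_smul, smul_sub, map_sub]
    abel
  have e2 : A (v s y) = σ • B (v s y) := by
    rw [hB, smul_apply, smul_smul, mul_inv_cancel₀ hσ, one_smul]
  have key : σ • (fderiv ℝ (v s) y ((y - xc) + B (y - xc)) + v s y + (2 * s) • timeDeriv v s y -
      B (v s y)) = 0 := by rw [h, smul_zero]
  rw [e1, map_smul, e2, ← key]
  simp only [smul_add, smul_sub, smul_smul]
  congr 1
  ring_nf

/-- The parameter `ρ(s) = log √((θ+1)/(−s))` (`s < 0`, `θ > 0`) lands on the slice `t = −1`: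
`θ + e^{2ρ(s)} s = θ − (θ + 1) = −1`. [folklore] -/
theorem rss_anchor {θ s : ℝ} (hθ : 0 < θ) (hs : s < 0) :
    θ + Real.exp (Real.log (Real.sqrt ((θ + 1) / (-s)))) ^ 2 * s = -1 := by
  have hq : 0 < (θ + 1) / (-s) := div_pos (by linarith) (by linarith)
  rw [Real.exp_log (Real.sqrt_pos.2 hq), Real.sq_sqrt hq.le]
  have e : (θ + 1) / (-s) * s = -(θ + 1) := by
    rw [div_neg, neg_mul, div_mul_cancel₀ _ hs.ne]
  rw [e]
  ring

/-- For `θ > 0` and `m > 0` there is a parameter `ρ` with `θe^{−2ρ} < m` (`e^{2ρ} ≥ 1 + 2ρ`,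
take `ρ = θ/m`). [folklore] -/
theorem rss_exists_small {θ m : ℝ} (hθ : 0 < θ) (hm : 0 < m) :
    ∃ ρ : ℝ, θ / Real.exp ρ ^ 2 < m := by
  refine ⟨θ / m, ?_⟩
  rw [div_lt_iff₀ (by positivity)]
  have h1 : 2 * (θ / m) + 1 ≤ Real.exp (2 * (θ / m)) := Real.add_one_le_exp _
  have h2 : Real.exp (2 * (θ / m)) = Real.exp (θ / m) ^ 2 := by
    rw [sq, ← Real.exp_add]
    ring_nf
  calc θ < 2 * θ + m := by linarith
    _ = m * (2 * (θ / m) + 1) := by field_simp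
    _ ≤ m * Real.exp (θ / m) ^ 2 := by
        rw [← h2]
        exact mul_le_mul_of_nonneg_left h1 hm.le

/-- **Gluing lemma for the Type-I ancient mild class.** If for every `t₁ < 0` and `ε > 0`
there are `0 ≤ δ < ε` with `t₁ + δ < 0` and `G ∈ A_C` (`IsTypeIAncientMild C G`) with
`v(s, ·) = G(s + δ, ·)` for all `s < t₁`, then `v ∈ A_{2C}`: smoothness, divergence-freeness and
the Oseen identity between `s < t < 0` only involve `v` on a backward end, where it is a
time-translate of `G` (`oseenDuhamel_comp_sub_right`; KNSS 2009, §1), and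
`‖v(s, y)‖ = ‖G(s + δ, y)‖ ≤ C/√(−s−δ) ≤ 2C/√(−s)` for `δ < −s/2`. [folklore] -/
theorem rss_isTypeIAncientMild_of_local [FiniteDimensional ℝ E] [MeasurableSpace E] [BorelSpace E]
    {C : ℝ} {v : ℝ → E → E}
    (h : ∀ t₁ < (0 : ℝ), ∀ ε > (0 : ℝ), ∃ (δ : ℝ) (G : ℝ → E → E), 0 ≤ δ ∧ δ < ε ∧ t₁ + δ < 0 ∧
      IsTypeIAncientMild C G ∧ ∀ s < t₁, ∀ y, v s y = G (s + δ) y) :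
    IsTypeIAncientMild (2 * C) v := by
  refine ⟨?_, ?_, ?_, ?_⟩
  · rintro ⟨s, y⟩ ⟨hs, -⟩
    have hs' : s < 0 := hs
    obtain ⟨δ, G, -, -, hδ1, hG, hvG⟩ := h (s / 2) (by linarith) 1 one_pos
    have hV : IsOpen (Iio (s / 2) ×ˢ (univ : Set E)) := isOpen_Iio.prod isOpen_univ
    have hmem : (s, y) ∈ Iio (s / 2) ×ˢ (univ : Set E) := ⟨show s < s / 2 by linarith, mem_univ _⟩
    have hGs : ContDiffOn ℝ (⊤ : ℕ∞) (uncurry fun σ z => G (σ + δ) z)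
        (Iio (s / 2) ×ˢ (univ : Set E)) := by
      have e : (uncurry fun σ z => G (σ + δ) z) = uncurry G ∘ fun p : ℝ × E => (p.1 + δ, p.2) := rfl
      rw [e]
      refine hG.contDiffOn.comp ((contDiff_fst.add contDiff_const).prodMk contDiff_snd).contDiffOn ?_
      rintro ⟨σ, z⟩ ⟨hσ, -⟩
      exact ⟨show σ + δ < 0 by have hσ' : σ < s / 2 := hσ; linarith, mem_univ _⟩
    have hAt : ContDiffAt ℝ (⊤ : ℕ∞) (uncurry fun σ z => G (σ + δ) z) (s, y) :=
      hGs.contDiffAt (hV.mem_nhds hmem)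
    have hEq : uncurry v =ᶠ[𝓝 (s, y)] uncurry fun σ z => G (σ + δ) z :=
      Filter.eventuallyEq_of_mem (hV.mem_nhds hmem) fun p hp => hvG p.1 hp.1 p.2
    exact (hAt.congr_of_eventuallyEq hEq).contDiffWithinAt
  · intro s hs
    obtain ⟨δ, G, -, -, hδ1, hG, hvG⟩ := h (s / 2) (by linarith) 1 one_pos
    have e : v s = G (s + δ) := funext fun y => hvG s (by linarith) y
    rw [e]
    exact hG.isDivFree (by linarith)
  · intro s t hst ht y
    obtain ⟨δ, G, -, -, hδ1, hG, hvG⟩ := h (t / 2) (by linarith) 1 one_pos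
    have ht2 : t < t / 2 := by linarith
    have evs : v s = G (s + δ) := funext fun z => hvG s (hst.trans ht2) z
    have eD : oseenDuhamel 1 s v v t y =
        oseenDuhamel 1 s (fun τ => G (τ - (-δ))) (fun τ => G (τ - (-δ))) t y := by
      simp only [oseenDuhamel_apply]
      refine MeasureTheory.setIntegral_congr_fun measurableSet_Ioo fun τ hτ => ?_
      have eτ : v τ = G (τ - (-δ)) := by
        rw [sub_neg_eq_add]
        exact funext fun z => hvG τ (hτ.2.trans ht2) z
      rw [eτ]
    rw [hvG t ht2 y, evs, eD, oseenDuhamel_comp_sub_right, sub_neg_eq_add, sub_neg_eq_add]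
    have key := hG.mild_eq (s := s + δ) (t := t + δ) (by linarith) (by linarith) y
    rw [show t + δ - (s + δ) = t - s by ring] at key
    exact key
  · intro s hs y
    obtain ⟨δ, G, hδ0, hδε, -, hG, hvG⟩ := h (s / 2) (by linarith) (-s / 2) (by linarith)
    rw [hvG s (by linarith) y]
    have hC : 0 ≤ C := hG.nonneg
    refine (hG.norm_le (t := s + δ) (by linarith) y).trans ?_
    rw [div_le_div_iff₀ (Real.sqrt_pos.2 (by linarith)) (Real.sqrt_pos.2 (by linarith))]
    have h4 : Real.sqrt (-s) ≤ 2 * Real.sqrt (-(s + δ)) := by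
      rw [← show Real.sqrt 4 = 2 by rw [show (4 : ℝ) = 2 ^ 2 by norm_num, Real.sqrt_sq zero_le_two],
        ← Real.sqrt_mul (by norm_num : (0 : ℝ) ≤ 4)]
      exact Real.sqrt_le_sqrt (by linarith)
    calc C * Real.sqrt (-s) ≤ C * (2 * Real.sqrt (-(s + δ))) := mul_le_mul_of_nonneg_left h4 hC
      _ = 2 * C * Real.sqrt (-(s + δ)) := by ring

end Literature.Analysis.FluidPDE

end
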